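/-
Copyright (c) 2026 the pub-hodgecm-mathlib formalisation cell (harness21).  Prover seat hodgecm-mathlib-F0P3-p01 (g31), «(D-RAM) FOUR-FRAME» road of crux H413, line LH4,
unit U3_Laws, κ-STAGE B brick κG₂ «G₁-κ» (dealer LH4-plan (g11) WORD #52 (a); letter LH4-p09 (g3) `LETTER-kappaBG-tv2.v1` §2–§3, κ owner LH4-p05 (g3)).
FILE κG₂-B — THE CLASS SUMS OF THE TYPE-2 BRACKETS over the level `ρ+1+2t` and over a glue sub-ball, and the (class, coset) SWAP.  2026-09-04.
-/
import Summits.HodgeConjecture.HodgeConjecture.Theorems.F0P3cDyRamDiagonalKappaGluedClassSums    -- ★ κG-B2 p856700 (LH4-p09 (g3)): the character sums over fixed class systems (generic level); brings κG-B1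
import HarnessLib

/-!
# Crux `H413`, κ-STAGE B brick κG₂, FILE B: the sums of the type-2 brackets `([2d ≤ ρ+2t+2]ω(−1)ω(1+f), [2d ≤ ρ+2]ω(−1)ω(f)ω(1+f), [2d ≤ ρ+2]ω(f))` over class systems at level `ρ+1+2t`

Cell `hodgecm-mathlib` (D-0151), FLOOR 0, crux item H413 = `stmt-HodgeConjecture-24833`; lane `--supports stmt-HodgeConjecture-24833 --as helper` (count-neutral).  THEOREMS ONLY
(no `def`, no instance, no notation, no `sorry`).  By ★ κG₂-A2 (`kappaCount_two_latt_glued_rep`) the κ-count of the type-2 glued class representative `latt V(1,1,g)` is the sum,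
over the (R)-parameters `f ≡ g (𝔭^{ρ+2t})` modulo `𝔭^{ρ+2t+1}`, of the bracket vector above; summing over the class representatives `g` (★ κG₂-C1) therefore gives the sum of the
brackets over a complete irredundant system at the FINER level `ρ+1+2t` (§1 `sum_sum_filter_near_eq`: each fine class lies in exactly one coarse class).  §2–§3 evaluate those
sums by LH4-p09 (g3)'s ★ κG-B2 lemmas VERBATIM at `ρ ↦ ρ+1` (the brackets ARE the type-0 windows at `ρ+1`): over the whole level (TUBE₂:
`(ω(−1)·((q−1)q^{⌈(ρ+1)∕2⌉−1}[d ≤ t] − q^{⌈(ρ+1)∕2⌉−1}[t+1 = d]), 0, 0)`) and over a glue sub-ball `{f : |f − c₀| ≤ |ϖ|^k}` (`([2d ≤ k+1]ω(−1)ω(1+c₀), [2d+2t ≤ k+1]ω(−1)ω(c₀)ω(1+c₀),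
[2d+2t ≤ k+1]ω(c₀)) · q^{⌈(ρ+1+2t)∕2⌉ − ⌈k∕2⌉}`).  Type-2 twins of ★ p856706 §1 (LH4-p09 (g3)); letter κB-G₂ v1 §2–§3; REF5 R5-108 numerics.
HONEST LABEL.  Count-neutral (`--supports`); the κ-laws stay PROVER TARGETS; `HC_CM` is proved only modulo the 7 printed citations (2 remaining named inputs: hLiu418 =
`stmt-HodgeConjecture-24832`, h413 = `stmt-HodgeConjecture-24833`) until rung 0 closes.

## References
* [Kottwitz1986BaseChangeUnits] R. E. Kottwitz, *Base change for unit elements of Hecke algebras*, Compositio Math. 60 (1986), §1 pp. 240–241 (fixed-lattice counts via torus orbits).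
* [LanglandsShelstad1987] R. P. Langlands, D. Shelstad, *On the definition of transfer factors*, Math. Ann. 278 (1987), §3 (the κ-signs).
* [Serre1979] J.-P. Serre, *Local Fields*, GTM 67 (1979), Ch. V §3 Prop. 5, Cor. 3; Ch. XV §2.
-/

set_option autoImplicit false

noncomputable section

namespace Summit.HodgeConjecture.HodgeConjecture.Cruxes.H413.F0P3cDyRamDiagonalKappaGluedClassSumsTwo

open Matrix WithZero
open Literature.NumberTheory.Automorphic Literature.NumberTheory.Automorphic.HermitianLattice
open Literature.NumberTheory.Automorphic.UnitaryLatticeTree Literature.NumberTheory.Automorphic.UnitaryThreeFourFrame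
open Literature.NumberTheory.LocalFields.WildQuadraticDatum
open Summit.HodgeConjecture.HodgeConjecture.Cruxes.H413.F0P3cDyRamDiagonalKappaGluedClassSums
open scoped Valued WithZero Matrix MatrixGroups

/-! ## §1  The swap: summing over the fine classes inside each coarse class is summing over the fine classes -/

/-- **COARSE-BY-FINE = FINE**: if every `f ∈ R⁺` is `P`-near exactly one `g ∈ R`, then `Σ_{g ∈ R} Σ_{f ∈ R⁺, P g f} φ(f) = Σ_{f ∈ R⁺} φ(f)`. [cite: Kottwitz1986BaseChangeUnits, §1 pp. 240–241] -/
theorem sum_sum_filter_near_eq {K M : Type} [DecidableEq K] [AddCommMonoid M] (R Rp : Finset K) (P : K → K → Prop) [DecidableRel P]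
    (hcover : ∀ f ∈ Rp, ∃ g ∈ R, P g f) (huniq : ∀ f ∈ Rp, ∀ g ∈ R, ∀ g' ∈ R, P g f → P g' f → g = g') (φ : K → M) :
    ∑ g ∈ R, ∑ f ∈ Rp.filter (fun f => P g f), φ f = ∑ f ∈ Rp, φ f := by
  have hdisj : (↑R : Set K).PairwiseDisjoint (fun g => Rp.filter (fun f => P g f)) := by
    intro g hg g' hg' hne
    rw [Function.onFun, Finset.disjoint_left]
    intro f hf hf'
    obtain ⟨hfR, hPg⟩ := Finset.mem_filter.1 hf
    obtain ⟨-, hPg'⟩ := Finset.mem_filter.1 hf'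
    exact hne (huniq f hfR g hg g' hg' hPg hPg')
  have hcov : R.biUnion (fun g => Rp.filter (fun f => P g f)) = Rp := by
    ext f
    simp only [Finset.mem_biUnion, Finset.mem_filter]
    constructor
    · rintro ⟨g, -, hf, -⟩; exact hf
    · intro hf
      obtain ⟨g, hg, hP⟩ := hcover f hf
      exact ⟨g, hg, hf, hP⟩
  rw [← Finset.sum_biUnion hdisj, hcov]

section Sums

variable {K : Type} [Field K] [Valued K ℤᵐ⁰] [CompleteSpace K] [Finite 𝓀[K]] {σ : K →+* K} {ϖ : K} {d t₂ : ℕ}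

/-! ## §2  The bracket sum over the whole level `ρ+1+2t` (TUBE₂) -/

/-- **THE TYPE-2 BRACKET SUM OVER THE WHOLE LEVEL (TUBE₂)**, slot by slot: with `R` a complete irredundant system of the fixed elements of valuation `|ϖ|^{2t}` modulo `𝔭^{ρ+1+2t}`
of size `(q−1)q^{⌈(ρ+1)∕2⌉−1}`: slot 0 `= ω(−1)·((q−1)q^{⌈(ρ+1)∕2⌉−1}·[d ≤ t] − q^{⌈(ρ+1)∕2⌉−1}·[t+1 = d])`, slots 1, 2 `= 0` (★ κG-B2 at `ρ ↦ ρ+1`).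
[cite: Kottwitz1986BaseChangeUnits, §1 pp. 240–241] [cite: LanglandsShelstad1987, §3] [cite: Serre1979, Ch. V §3 Prop. 5, Cor. 3] -/
theorem sum_bracket_two_level (hD : IsRamifiedQuadraticDatum σ ϖ d t₂) (h2 : Valued.v (2 : K) < 1) {ρ t' : ℕ} (ht' : 1 ≤ t')
    (R : Finset K) (hR1 : ∀ g ∈ R, σ g = g ∧ Valued.v g = Valued.v ϖ ^ (2 * t'))
    (hR2 : ∀ f : K, σ f = f → Valued.v f = Valued.v ϖ ^ (2 * t') → ∃ g ∈ R, Valued.v (f - g) ≤ Valued.v ϖ ^ (ρ + 1 + 2 * t'))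
    (hR3 : ∀ g ∈ R, ∀ g' ∈ R, Valued.v (g - g') ≤ Valued.v ϖ ^ (ρ + 1 + 2 * t') → g = g')
    (hRcard : R.card = (Nat.card 𝓀[K] - 1) * Nat.card 𝓀[K] ^ ((ρ + 1 + 1) / 2 - 1)) (i : Fin 3) :
    ∑ g ∈ R, (((![if 2 * d ≤ ρ + 2 * t' + 2 then normSign σ (-1) * normSign σ (1 + g) else 0,
         if 2 * d ≤ ρ + 2 then normSign σ (-1) * normSign σ g * normSign σ (1 + g) else 0,
         if 2 * d ≤ ρ + 2 then normSign σ g else 0] : Fin 3 → ℤ) i : ℤ) : ℚ) =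
      (![(normSign σ (-1 : K) : ℚ) * ((if d ≤ t' then ((Nat.card 𝓀[K] : ℚ) - 1) * (Nat.card 𝓀[K] : ℚ) ^ ((ρ + 1 + 1) / 2 - 1) else 0) -
          (if t' + 1 = d then (Nat.card 𝓀[K] : ℚ) ^ ((ρ + 1 + 1) / 2 - 1) else 0)), 0, 0] : Fin 3 → ℚ) i := by
  -- the level set is stable under every fixed unit
  have hA : ∀ g ∈ ({g : K | σ g = g ∧ Valued.v g = Valued.v ϖ ^ (2 * t')} : Set K), σ g = g ∧ Valued.v g = Valued.v ϖ ^ (2 * t') := fun g hg => hg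
  have hAst : ∀ g ∈ ({g : K | σ g = g ∧ Valued.v g = Valued.v ϖ ^ (2 * t')} : Set K), ∀ n : K, σ n = n → Valued.v n = 1 →
      Valued.v (n - 1) ≤ Valued.v ϖ ^ (2 * (d - 1)) → n * g ∈ ({g : K | σ g = g ∧ Valued.v g = Valued.v ϖ ^ (2 * t')} : Set K) :=
    fun g hg n hσn hn1 _ => ⟨by rw [map_mul, hσn, hg.1], by rw [map_mul, hn1, one_mul, hg.2]⟩
  have hR1' : ∀ g ∈ R, g ∈ ({g : K | σ g = g ∧ Valued.v g = Valued.v ϖ ^ (2 * t')} : Set K) := hR1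
  have hR2' : ∀ f ∈ ({g : K | σ g = g ∧ Valued.v g = Valued.v ϖ ^ (2 * t')} : Set K), ∃ g ∈ R, Valued.v (f - g) ≤ Valued.v ϖ ^ (ρ + 1 + 2 * t') :=
    fun f hf => hR2 f hf.1 hf.2
  fin_cases i
  · -- slot 0
    simp only [Fin.zero_eta, Fin.isValue, Matrix.cons_val_zero]
    by_cases hW : 2 * d ≤ ρ + 2 * t' + 2
    · simp only [if_pos hW, Int.cast_mul, ← Finset.mul_sum]
      rw [← Int.cast_sum]
      congr 1
      rcases Nat.lt_trichotomy (t' + 1) d with hlt | heq | hgt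
      · -- dead below the boundary
        rw [if_neg (by omega), if_neg (by omega), sub_zero,
          sum_normSign_one_add_eq_zero hD h2 ht' (ρ := ρ + 1) (by omega) hA (fun g hg n hσn hn1 hn => ?_) R hR1' hR2' hR3, Int.cast_zero]
        have hϖ := hD.2.2.1
        have hϖ0 : ϖ ≠ 0 := (Valuation.ne_zero_iff _).1 (by rw [hϖ]; exact WithZero.exp_ne_zero)
        have hϖ1 : Valued.v ϖ < 1 := by rw [hϖ, ← WithZero.exp_zero, WithZero.exp_lt_exp]; norm_num
        refine ⟨by rw [map_sub, map_mul, map_add, map_one, hσn, hg.1], ?_⟩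
        rw [show n * (1 + g) - 1 = n * g + (n - 1) by ring]
        have hlt' : Valued.v (n - 1) < Valued.v (n * g) := by
          rw [map_mul, hn1, one_mul, hg.2]
          exact hn.trans_lt (pow_lt_pow_right_of_lt_one₀ ((Valuation.pos_iff _).2 hϖ0) hϖ1 (by omega))
        rw [Valuation.map_add_eq_of_lt_left _ hlt', map_mul, hn1, one_mul, hg.2]
      · -- the boundary
        rw [if_neg (by omega), if_pos heq, zero_sub, sum_normSign_one_add_boundary hD h2 (ρ := ρ + 1) (by omega) ht' heq R hR1 hR2 hR3]
        push_cast; ring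
      · -- deep
        rw [if_pos (by omega), if_neg (by omega), sub_zero, sum_normSign_one_add_eq_card_of_le hD (by omega) R hR1, hRcard]
        have hq : 1 ≤ Nat.card 𝓀[K] := Nat.one_le_iff_ne_zero.2 Nat.card_pos.ne'
        push_cast [Nat.cast_sub hq]; ring
    · simp only [if_neg hW, Int.cast_zero, Finset.sum_const_zero]
      rw [if_neg (by omega), if_neg (by omega)]; ring
  · -- slot 1
    simp only [Fin.mk_one, Fin.isValue, Matrix.cons_val_one, Matrix.cons_val_zero]
    by_cases hW : 2 * d ≤ ρ + 2
    · simp only [if_pos hW]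
      have e : ∑ x ∈ R, ((normSign σ (-1) * normSign σ x * normSign σ (1 + x) : ℤ) : ℚ) =
          (normSign σ (-1) : ℚ) * ((∑ x ∈ R, normSign σ x * normSign σ (1 + x) : ℤ) : ℚ) := by
        push_cast
        rw [Finset.mul_sum]
        exact Finset.sum_congr rfl fun x _ => by ring
      rw [e, sum_normSign_mul_normSign_one_add_eq_zero hD h2 (ρ := ρ + 1) (by omega) ht' hA hAst R hR1' hR2' hR3, Int.cast_zero, mul_zero]
    · simp only [if_neg hW, Int.cast_zero, Finset.sum_const_zero]
  · -- slot 2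
    simp only [Fin.reduceFinMk, Matrix.cons_val_two, Matrix.tail_cons, Matrix.head_cons]
    by_cases hW : 2 * d ≤ ρ + 2
    · simp only [if_pos hW]
      norm_cast
      exact sum_normSign_eq_zero hD h2 (ρ := ρ + 1) (by omega) hA hAst R hR1' hR2' hR3
    · simp only [if_neg hW, Int.cast_zero, Finset.sum_const_zero]

/-! ## §3  The bracket sum over a glue sub-ball -/

/-- **THE TYPE-2 BRACKET SUM OVER A GLUE SUB-BALL** `{f = σf : |f − c₀| ≤ |ϖ|^k}` (`|c₀| = |ϖ|^{2t}`, `2t < k ≤ ρ+1+2t`), slot by slot, with its class count `q^{⌈(ρ+1+2t)∕2⌉ − ⌈k∕2⌉}`: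
slot 0 `= [2d ≤ k+1]·ω(−1)ω(1+c₀)·#S`, slot 1 `= [2d+2t ≤ k+1]·ω(−1)ω(c₀)ω(1+c₀)·#S`, slot 2 `= [2d+2t ≤ k+1]·ω(c₀)·#S` (★ κG-B2 §2–§4 at `ρ ↦ ρ+1`).
[cite: Kottwitz1986BaseChangeUnits, §1 pp. 240–241] [cite: LanglandsShelstad1987, §3] [cite: Serre1979, Ch. V §3 Prop. 5, Cor. 3] -/
theorem sum_bracket_two_subBall (hD : IsRamifiedQuadraticDatum σ ϖ d t₂) (h2 : Valued.v (2 : K) < 1) {ρ t' k : ℕ} (ht' : 1 ≤ t')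
    (hk : 2 * t' < k) (hkρ : k ≤ ρ + 1 + 2 * t') {c₀ : K} (hσc₀ : σ c₀ = c₀) (hc₀ : Valued.v c₀ = Valued.v ϖ ^ (2 * t')) (S : Finset K)
    (hS1 : ∀ g ∈ S, g ∈ {g : K | σ g = g ∧ Valued.v (g - c₀) ≤ Valued.v ϖ ^ k})
    (hS2 : ∀ f ∈ {g : K | σ g = g ∧ Valued.v (g - c₀) ≤ Valued.v ϖ ^ k}, ∃ g ∈ S, Valued.v (f - g) ≤ Valued.v ϖ ^ (ρ + 1 + 2 * t'))
    (hS3 : ∀ g ∈ S, ∀ g' ∈ S, Valued.v (g - g') ≤ Valued.v ϖ ^ (ρ + 1 + 2 * t') → g = g') (i : Fin 3) :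
    ∑ g ∈ S, (((![if 2 * d ≤ ρ + 2 * t' + 2 then normSign σ (-1) * normSign σ (1 + g) else 0,
         if 2 * d ≤ ρ + 2 then normSign σ (-1) * normSign σ g * normSign σ (1 + g) else 0,
         if 2 * d ≤ ρ + 2 then normSign σ g else 0] : Fin 3 → ℤ) i : ℤ) : ℚ) =
      (![if 2 * d ≤ k + 1 then (normSign σ (-1 : K) : ℚ) * normSign σ (1 + c₀) else 0,
         if 2 * d + 2 * t' ≤ k + 1 then (normSign σ (-1 : K) : ℚ) * normSign σ c₀ * normSign σ (1 + c₀) else 0,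
         if 2 * d + 2 * t' ≤ k + 1 then (normSign σ c₀ : ℚ) else 0] : Fin 3 → ℚ) i *
        (Nat.card 𝓀[K] : ℚ) ^ ((ρ + 1 + 2 * t' + 1) / 2 - (k + 1) / 2) := by
  have hlev : ∀ g ∈ ({g : K | σ g = g ∧ Valued.v (g - c₀) ≤ Valued.v ϖ ^ k} : Set K), σ g = g ∧ Valued.v g = Valued.v ϖ ^ (2 * t') :=
    fun g hg => level_of_mem_subBall hD hk hc₀ hg
  have hcard : (S.card : ℚ) = (Nat.card 𝓀[K] : ℚ) ^ ((ρ + 1 + 2 * t' + 1) / 2 - (k + 1) / 2) := by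
    rw [card_repr_subBall hD hkρ hσc₀ S hS1 hS2 hS3]; push_cast; rfl
  fin_cases i
  · -- slot 0
    simp only [Fin.zero_eta, Fin.isValue, Matrix.cons_val_zero]
    by_cases hW : 2 * d ≤ ρ + 2 * t' + 2
    · simp only [if_pos hW, Int.cast_mul, ← Finset.mul_sum]
      rw [← Int.cast_sum]
      by_cases hB : 2 * d ≤ k + 1
      · rw [if_pos hB, sum_normSign_one_add_subBall_eq hD ht' (by omega) hσc₀ hc₀ S hS1, ← hcard]; push_cast; ring
      · rw [if_neg hB, zero_mul, sum_normSign_one_add_eq_zero hD h2 ht' (ρ := ρ + 1) (by omega) hlev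
          (fun g hg n hσn hn1 hn => twist_mem_subBall hD (by omega) hc₀ hg hσn hn1 hn) S hS1 hS2 hS3, Int.cast_zero, mul_zero]
    · simp only [if_neg hW, Int.cast_zero, Finset.sum_const_zero]
      rw [if_neg (by omega), zero_mul]
  · -- slot 1
    simp only [Fin.mk_one, Fin.isValue, Matrix.cons_val_one, Matrix.cons_val_zero]
    by_cases hW : 2 * d ≤ ρ + 2
    · simp only [if_pos hW]
      have e : ∑ x ∈ S, ((normSign σ (-1) * normSign σ x * normSign σ (1 + x) : ℤ) : ℚ) =
          (normSign σ (-1) : ℚ) * ((∑ x ∈ S, normSign σ x * normSign σ (1 + x) : ℤ) : ℚ) := by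
        push_cast
        rw [Finset.mul_sum]
        exact Finset.sum_congr rfl fun x _ => by ring
      rw [e]
      by_cases hB : 2 * d + 2 * t' ≤ k + 1
      · rw [if_pos hB, (sum_normSign_subBall_eq hD ht' (by omega) hσc₀ hc₀ S hS1).2, ← hcard]; push_cast; ring
      · rw [if_neg hB, zero_mul, sum_normSign_mul_normSign_one_add_eq_zero hD h2 (ρ := ρ + 1) (by omega) ht' hlev
          (fun g hg n hσn hn1 hn => mul_mem_subBall hD (by omega) hc₀ hg hσn hn1 hn) S hS1 hS2 hS3, Int.cast_zero, mul_zero]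
    · simp only [if_neg hW, Int.cast_zero, Finset.sum_const_zero]
      rw [if_neg (by omega), zero_mul]
  · -- slot 2
    simp only [Fin.reduceFinMk, Matrix.cons_val_two, Matrix.tail_cons, Matrix.head_cons]
    by_cases hW : 2 * d ≤ ρ + 2
    · simp only [if_pos hW]
      rw [← Int.cast_sum]
      by_cases hB : 2 * d + 2 * t' ≤ k + 1
      · rw [if_pos hB, (sum_normSign_subBall_eq hD ht' (by omega) hσc₀ hc₀ S hS1).1, ← hcard]; push_cast; ring
      · rw [if_neg hB, zero_mul, sum_normSign_eq_zero hD h2 (ρ := ρ + 1) (by omega) hlev (fun g hg n hσn hn1 hn => mul_mem_subBall hD (by omega) hc₀ hg hσn hn1 hn)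
          S hS1 hS2 hS3, Int.cast_zero]
    · simp only [if_neg hW, Int.cast_zero, Finset.sum_const_zero]
      rw [if_neg (by omega), zero_mul]

end Sums

end Summit.HodgeConjecture.HodgeConjecture.Cruxes.H413.F0P3cDyRamDiagonalKappaGluedClassSumsTwo

end
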